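import Summits.KontsevichZagierPeriods.Zeta5Search.Certificates.RecordRayLineProfile
import Summits.KontsevichZagierPeriods.Zeta5Search.Certificates.RecordRayForms
import Summits.KontsevichZagierPeriods.Zeta5Search.Certificates.RecordRayDualSeries
import HarnessLib

/-!
# ζ(5) search — certificates: the lattice line `ℤ + iY` through the record ray's summand — maximum and majorant
(cell `pub-zeta5`, certifier 2, generation 2)

HONEST FRAMING: systematic search; no irrationality claim unless certified.

OUR work (Summit side). For the record ray `b = bRecord n` (`e = 0`) and its partner `b′ = bRecord' n` (`e = 1`),
both of the form `natB (41n) (BrecE e n)`, and a height `Y` at which the step certificate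
(`stepDen ≤ stepNum` for `a ≥ 1/2`, `Certificates/RecordRayLineStep*`) and the decay certificate
(`stepDen·(a+1/2)⁴ ≤ stepNum·(a−1/2)⁴` for `a ≥ 20n`, `Certificates/RecordRayLineDecay*`) hold:

* `NSq_symm` — `N(−2h−x) = N(x)` for `N(x) = |R_b(x+iY)|²`, `h = (41n+2)/2` (well-poised reflection);
* `NSq_int_le_Mx` — for every `k ∈ ℤ`: `N(k) ≤ Mx`, `Mx = max(N(−h), N(−h−1/2))` (the centre values);
* the decay beyond `|k+h| ≥ 20n+1/2` and the summable majorant are in `Certificates/RecordRayLineMajorant.lean`.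
-/

noncomputable section

open Finset Complex Filter Topology

namespace Summit.KontsevichZagierPeriods.Zeta5Search.RecordLine

open Summit.KontsevichZagierPeriods.Zeta5Search.DualSeries
open Summit.KontsevichZagierPeriods.Zeta5Search.DualSeriesBounds (natB natB_zero natB_succ)
open Summit.KontsevichZagierPeriods.Zeta5Search.DualSeriesLemma19 (bRecord)
open Summit.KontsevichZagierPeriods.Zeta5Search.RecordRay (Brec bRecord_eq_natB bRecord')
open Summit.KontsevichZagierPeriods.Zeta5Search.DualPF (Rc)

/-! ### The record ray and its partner as `natB (41n) (BrecE e n)` -/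

/-- `BrecE 0 n = Brec n`. -/
theorem BrecE_zero (n : ℕ) : BrecE 0 n = Brec n := by
  funext j; simp [BrecE, Brec]

/-- `bRecord n = natB (41n) (BrecE 0 n)`. -/
theorem bRecord_eq (n : ℕ) : bRecord n = natB (41 * n) (BrecE 0 n) := by
  rw [BrecE_zero, bRecord_eq_natB]

/-- `bRecord' n = natB (41n) (BrecE 1 n)` (the partner `b + e₇`: seventh slot `11n + 1`). -/
theorem bRecord'_eq (n : ℕ) : bRecord' n = natB (41 * n) (BrecE 1 n) := by
  funext j
  unfold bRecord'
  rw [bRecord_eq_natB]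
  by_cases hj : j = 7
  · subst hj
    simp [Function.update, natB, BrecE, Brec]
  · rw [Function.update_of_ne hj]
    rcases Nat.lt_or_ge j 8 with h8 | h8
    · interval_cases j <;> simp_all [natB, BrecE, Brec]
    · simp [natB, show j ≠ 0 by omega, show ¬ j ≤ 7 by omega]

/-! ### The squared modulus as a function on the line, and its reflection symmetry -/

/-- `N_e(x) = |R_b(x + iY)|²` for `b = natB (41n) (BrecE e n)`. -/
def NSq (e n : ℕ) (Y x : ℝ) : ℝ := ‖Rc (natB (41 * n) (BrecE e n)) ((x : ℂ) + Y * I)‖ ^ 2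

/-- `N ≥ 0`. -/
theorem NSq_nonneg (e n : ℕ) (Y x : ℝ) : 0 ≤ NSq e n Y x := by unfold NSq; positivity

/-- `q` is even. -/
theorem qsq_neg (Y u : ℝ) : qsq Y (-u) = qsq Y u := by unfold qsq; ring

/-- Reflection symmetry of the numerator product: `Nm(−(B₀+2)−x) = Nm(x)`. -/
theorem Nm_symm (B₀ : ℕ) (Y x : ℝ) : Nm B₀ Y (-((B₀ : ℝ) + 2) - x) = Nm B₀ Y x := by
  unfold Nm
  congr 1
  · rw [show -((B₀ : ℝ) + 2) - x + ((B₀ : ℝ) + 2) / 2 = -(x + ((B₀ : ℝ) + 2) / 2) by ring, qsq_neg]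
  · rw [← prod_range_reflect (fun i => qsq Y (x + 1 + (i : ℝ))) (B₀ + 1)]
    refine prod_congr rfl fun i hi => ?_
    have hi' := mem_range.1 hi
    rw [show B₀ + 1 - 1 - i = B₀ - i by omega, Nat.cast_sub (by omega),
      show -((B₀ : ℝ) + 2) - x + 1 + (i : ℝ) = -(x + 1 + ((B₀ : ℝ) - i)) by ring, qsq_neg]

/-- Reflection symmetry of the denominator product: `D(−(B₀+2)−x) = D(x)` (each window is symmetric). -/
theorem Dx_symm (B₀ : ℕ) (B : ℕ → ℕ) (hreg : ∀ j ∈ range 7, 2 * B j ≤ B₀ + 1) (Y x : ℝ) :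
    Dx B₀ B Y (-((B₀ : ℝ) + 2) - x) = Dx B₀ B Y x := by
  unfold Dx
  refine prod_congr rfl fun j hj => ?_
  have hBj : B j ≤ B₀ + 1 - B j := by have := hreg j hj; omega
  have h := prod_Ico_reflect (fun i => qsq Y (x + 1 + (i : ℝ))) (B j) (m := B₀ + 1 - B j) (n := B₀) (by omega)
  rw [show B₀ + 1 - (B₀ + 1 - B j) = B j by omega] at h
  rw [← h]
  refine prod_congr rfl fun i hi => ?_
  have hi' := (mem_Ico.1 hi).2
  rw [Nat.cast_sub (by omega), show -((B₀ : ℝ) + 2) - x + 1 + (i : ℝ) = -(x + 1 + ((B₀ : ℝ) - i)) by ring,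
    qsq_neg]

/-- **Reflection symmetry**: `N_e(−(41n+2) − x) = N_e(x)` (`e ≤ 1`, `n ≥ 1`, `Y ≠ 0`). -/
theorem NSq_symm {e n : ℕ} (he : e ≤ 1) (hn : 1 ≤ n) {Y : ℝ} (hY : 0 < Y) (x : ℝ) :
    NSq e n Y (-(((41 * n : ℕ) : ℝ) + 2) - x) = NSq e n Y x := by
  have hreg := hreg_recE he hn
  have h1 := normSq_Rc_mul (41 * n) (BrecE e n) hreg (x := -(((41 * n : ℕ) : ℝ) + 2) - x) hY.ne'
  have h2 := normSq_Rc_mul (41 * n) (BrecE e n) hreg (x := x) hY.ne'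
  rw [Nm_symm, Dx_symm _ _ hreg] at h1
  have hD := Dx_pos (41 * n) (BrecE e n) hY x
  unfold NSq
  have e1 := (eq_div_iff hD.ne').2 h1
  have e2 := (eq_div_iff hD.ne').2 h2
  push_cast at e1 e2 ⊢
  rw [e1, e2]

/-! ### Iterating the monotone and the decaying step -/

/-- Iterated monotone step: if `F(x) ≤ F(x+1)` whenever `x + h ≤ −1`, then `F(x) ≤ F(x+m)` whenever
`x + h + m ≤ 0`. -/
theorem iter_mono {F : ℝ → ℝ} {h : ℝ} (hstep : ∀ x : ℝ, x + h ≤ -1 → F x ≤ F (x + 1)) :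
    ∀ (m : ℕ) (x : ℝ), x + h + m ≤ 0 → F x ≤ F (x + m) := by
  intro m
  induction m with
  | zero => intro x _; simp
  | succ m ih =>
    intro x hx
    push_cast at hx ⊢
    have h1 : F x ≤ F (x + m) := ih x (by linarith)
    have h2 : F (x + m) ≤ F (x + m + 1) := hstep (x + m) (by linarith)
    rw [show x + (m + 1 : ℝ) = x + m + 1 by ring]
    exact h1.trans h2

/-- Iterated step beyond a threshold: if `F(x) ≤ F(x+1)` whenever `c ≤ −(x+h)`, then `F(x) ≤ F(x+m)` whenever
`c ≤ −(x+h+m) + 1`. -/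
theorem iter_threshold {F : ℝ → ℝ} {h c : ℝ} (hstep : ∀ x : ℝ, c ≤ -(x + h) → F x ≤ F (x + 1)) :
    ∀ (m : ℕ) (x : ℝ), c ≤ -(x + h + m) + 1 → F x ≤ F (x + m) := by
  intro m
  induction m with
  | zero => intro x _; simp
  | succ m ih =>
    intro x hx
    push_cast at hx ⊢
    have h1 : F x ≤ F (x + m) := ih x (by linarith)
    have h2 : F (x + m) ≤ F (x + m + 1) := hstep (x + m) (by linarith)
    rw [show x + (m + 1 : ℝ) = x + m + 1 by ring]
    exact h1.trans h2

/-! ### Centre values -/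

/-- The centre value bound: `Mx = max(N(−h), N(−h − 1/2))`, `h = (41n+2)/2`. -/
def Mx (e n : ℕ) (Y : ℝ) : ℝ :=
  max (NSq e n Y (-((((41 * n : ℕ) : ℝ) + 2) / 2))) (NSq e n Y (-((((41 * n : ℕ) : ℝ) + 2) / 2) - 1 / 2))

/-- `Mx ≥ 0`. -/
theorem Mx_nonneg (e n : ℕ) (Y : ℝ) : 0 ≤ Mx e n Y := (NSq_nonneg _ _ _ _).trans (le_max_left _ _)

/-! ### The lattice bound -/

section Lattice

variable {e n : ℕ} (he : e ≤ 1) (hn : 1 ≤ n) {Y : ℝ} (hY : 0 < Y)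
  (hcert : ∀ a : ℝ, 1 / 2 ≤ a → stepDen e n Y a ≤ stepNum e n Y a)
include he hn hY hcert

/-- The monotone step in the variable `x`: `N(x) ≤ N(x+1)` for `x + h ≤ −1`. -/
theorem NSq_step_le (x : ℝ) (hx : x + ((((41 * n : ℕ) : ℝ) + 2) / 2) ≤ -1) :
    NSq e n Y x ≤ NSq e n Y (x + 1) := by
  have h := normSq_Rc_step_le he hn hY x (hcert _ (by push_cast at hx ⊢; linarith))
  unfold NSq
  simpa using h

/-- **Every lattice point to the left of the centre is dominated by the centre values.** -/
theorem NSq_int_le_Mx_left (k : ℤ) (hk : (k : ℝ) + ((((41 * n : ℕ) : ℝ) + 2) / 2) ≤ 0) :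
    NSq e n Y k ≤ Mx e n Y := by
  set h : ℝ := ((((41 * n : ℕ) : ℝ) + 2) / 2) with hh
  set v : ℝ := (k : ℝ) + h with hv
  -- number of steps
  set m : ℕ := ⌊-v⌋₊ with hm
  have hv0 : 0 ≤ -v := by linarith
  have hfl : (m : ℝ) ≤ -v := Nat.floor_le hv0
  have hfl' : -v < m + 1 := Nat.lt_floor_add_one (-v)
  have hmono := iter_mono (F := NSq e n Y) (h := h) (fun x hx => NSq_step_le he hn hY hcert x hx) m k
    (by linarith)
  refine hmono.trans ?_
  -- the landing point `y = k + m` has `y + h ∈ (−1, 0]` and `2(y+h) ∈ ℤ`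
  have hint : ∃ z : ℤ, 2 * ((k : ℝ) + m + h) = z := ⟨2 * k + 2 * m + (41 * n + 2 : ℕ), by
    rw [hh]; push_cast; ring⟩
  obtain ⟨z, hz⟩ := hint
  have hz1 : -2 < (z : ℝ) := by rw [← hz]; linarith
  have hz2 : (z : ℝ) ≤ 0 := by rw [← hz]; linarith
  have hz1' : -2 < z := by exact_mod_cast hz1
  have hz2' : z ≤ 0 := by exact_mod_cast hz2
  have hcases : z = 0 ∨ z = -1 := by omega
  rcases hcases with h0 | h1
  · -- landing at the centre
    have : (k : ℝ) + m = -h := by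
      have : 2 * ((k : ℝ) + m + h) = 0 := by rw [hz, h0]; simp
      linarith
    rw [this]
    exact le_max_left _ _
  · have : (k : ℝ) + m = -h - 1 / 2 := by
      have : 2 * ((k : ℝ) + m + h) = -1 := by rw [hz, h1]; simp
      linarith
    rw [this]
    exact le_max_right _ _

omit hcert in
/-- Reflection on the lattice: `N(−(41n+2) − k) = N(k)` for `k ∈ ℤ`. -/
theorem NSq_symm_int (k : ℤ) : NSq e n Y ((-((41 * n + 2 : ℕ) : ℤ) - k : ℤ) : ℝ) = NSq e n Y k := by
  have h := NSq_symm he hn hY (x := (k : ℝ))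
  have e1 : ((-((41 * n + 2 : ℕ) : ℤ) - k : ℤ) : ℝ) = -(((41 * n : ℕ) : ℝ) + 2) - (k : ℝ) := by
    push_cast; ring
  rw [e1]; exact h

/-- **`N(k) ≤ Mx` for every integer `k`.** -/
theorem NSq_int_le_Mx (k : ℤ) : NSq e n Y k ≤ Mx e n Y := by
  by_cases hk : (k : ℝ) + ((((41 * n : ℕ) : ℝ) + 2) / 2) ≤ 0
  · exact NSq_int_le_Mx_left he hn hY hcert k hk
  · -- reflect
    rw [← NSq_symm_int he hn hY k]
    apply NSq_int_le_Mx_left he hn hY hcert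
    push_cast at hk ⊢
    linarith

end Lattice

end Summit.KontsevichZagierPeriods.Zeta5Search.RecordLine
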